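import Mathlib
import HarnessLib
import Literature.Analysis.OperatorTheory.SchurComplementCount

/-!
# One-sided polynomial bounds for a Schur complement (`p(A) ⪰ A⁻¹` from `p ≥ 1/x` on the spectrum)

Companion to `Literature.Analysis.OperatorTheory.SchurComplementCount` (Haynsworth inertia additivity,
counting form). The one analytic input of "polynomially filtered" Schur-complement certificates
(Chebyshev / polynomial resolvent bounds, as used in eigenvalue-count and spectral-projector estimators):

* `aeval_sub_inv_posSemidef` — if the real symmetric matrix `A` satisfies `c•1 ⪯ A ⪯ cmax•1` with `0 < c`
  and the real polynomial `p` satisfies `1/x ≤ p(x)` on `[c, cmax]`, then `p(A) − A⁻¹ ⪰ 0`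
  (continuous functional calculus = spectral theorem for Hermitian matrices);
* `schur_poly_dotProduct_le` — hence `yᵀ(D − Bᵀ p(A) B)y ≤ yᵀ(D − Bᵀ A⁻¹ B)y`: the EXPLICIT matrix
  `D − Bᵀ p(A) B` (no linear solves) is a Loewner lower bound for the Schur complement;
* `fromBlocks_dotProduct_nonneg_of_schur_poly_cert` — combined with the counting form of Haynsworth's
  theorem: if `D − Bᵀ p(A) B + Σ_j t_j q_j q_jᵀ ⪰ 0` (one verified Cholesky / LDLᵀ of an explicit matrix plus a
  rank-`k` deflation), the block form `[[A, B], [Bᵀ, D]]` is nonnegative on `{(x, y) : q_j ⬝ y = 0 ∀ j}`, a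
  subspace of codimension `≤ k` — i.e. the block matrix has at most `k` negative eigenvalues.

Pure finite-dimensional linear algebra over `ℝ`; every hypothesis explicit. (Free block `A` first, pinned
block `D` second, as in `SchurComplementCount`.)
-/

namespace Literature.Analysis.OperatorTheory

open Matrix Polynomial
open scoped Matrix MatrixOrder

variable {m n : Type*} [Fintype m] [Fintype n] [DecidableEq m]

omit [Fintype m] in
/-- A real matrix `A` with `A − c•1` Hermitian is self-adjoint. [folklore] -/
private theorem isSelfAdjoint_of_isHermitian_sub_smul_one (A : Matrix m m ℝ) (c : ℝ)
    (h : (A - c • (1 : Matrix m m ℝ)).IsHermitian) : IsSelfAdjoint A := by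
  have h2 : (c • (1 : Matrix m m ℝ)).IsHermitian := by
    simp
  have h3 : A = (A - c • (1 : Matrix m m ℝ)) + c • (1 : Matrix m m ℝ) := by simp
  rw [h3]
  exact (h.add h2).isSelfAdjoint

/-- `c•1 ⪯ A ⪯ cmax•1` puts the (real) spectrum of `A` inside `[c, cmax]`. [folklore] -/
private theorem spectrum_subset_Icc_of_posSemidef (A : Matrix m m ℝ) (c cmax : ℝ)
    (hAc : (A - c • (1 : Matrix m m ℝ)).PosSemidef)
    (hAcmax : (cmax • (1 : Matrix m m ℝ) - A).PosSemidef) :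
    ∀ x ∈ spectrum ℝ A, c ≤ x ∧ x ≤ cmax := by
  have hA : IsSelfAdjoint A := isSelfAdjoint_of_isHermitian_sub_smul_one A c hAc.1
  have hlo : algebraMap ℝ (Matrix m m ℝ) c ≤ A := by
    rw [Algebra.algebraMap_eq_smul_one, ← sub_nonneg, Matrix.nonneg_iff_posSemidef]
    exact hAc
  have hhi : A ≤ algebraMap ℝ (Matrix m m ℝ) cmax := by
    rw [Algebra.algebraMap_eq_smul_one, ← sub_nonneg, Matrix.nonneg_iff_posSemidef]
    exact hAcmax
  intro x hx
  exact ⟨(algebraMap_le_iff_le_spectrum (a := A)).mp hlo x hx,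
    (le_algebraMap_iff_spectrum_le (a := A)).mp hhi x hx⟩

omit [Fintype m] in
/-- `c•1 ⪯ A` with `0 < c` makes `A` positive definite. [folklore] -/
private theorem posDef_of_posSemidef_sub_smul_one (A : Matrix m m ℝ) (c : ℝ) (hc : 0 < c)
    (hAc : (A - c • (1 : Matrix m m ℝ)).PosSemidef) : A.PosDef := by
  have h1 : (c • (1 : Matrix m m ℝ)).PosDef := Matrix.PosDef.one.smul hc
  have h3 : A = (A - c • (1 : Matrix m m ℝ)) + c • (1 : Matrix m m ℝ) := by simp
  rw [h3]
  exact Matrix.PosDef.posSemidef_add hAc h1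

/-- For a self-adjoint real matrix whose spectrum avoids `0`, the matrix inverse is the continuous
functional calculus of `x ↦ x⁻¹`. [folklore] -/
private theorem inv_eq_cfc_inv_of_spectrum_ne_zero (A : Matrix m m ℝ) (hA : IsSelfAdjoint A)
    (hne : ∀ x ∈ spectrum ℝ A, x ≠ 0) : A⁻¹ = cfc (fun x : ℝ => x⁻¹) A := by
  have hcont : ContinuousOn (fun x : ℝ => x⁻¹) (spectrum ℝ A) :=
    continuousOn_inv₀.mono (fun x hx => hne x hx)
  apply Matrix.inv_eq_right_inv
  calc A * cfc (fun x : ℝ => x⁻¹) A = cfc id A * cfc (fun x : ℝ => x⁻¹) A := by rw [cfc_id ℝ A]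
    _ = cfc (fun x : ℝ => id x * x⁻¹) A := by rw [← cfc_mul id (fun x : ℝ => x⁻¹) A]
    _ = cfc (fun _ : ℝ => (1 : ℝ)) A := by
        apply cfc_congr
        intro x hx
        simp [hne x hx]
    _ = 1 := cfc_const_one ℝ A

/-- **Polynomial upper bound for the inverse in the Loewner order.** If `c•1 ⪯ A ⪯ cmax•1` with `0 < c`
and `1/x ≤ p(x)` for all `x ∈ [c, cmax]`, then `p(A) − A⁻¹ ⪰ 0`. (Spectral theorem / continuous functional
calculus: `p(A) − A⁻¹ = g(A)` with `g(x) = p(x) − 1/x ≥ 0` on the spectrum, and a Hermitian matrix with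
nonnegative eigenvalues is positive semidefinite.) [cite: HornJohnson2013, Thm 7.2.1] -/
theorem aeval_sub_inv_posSemidef (A : Matrix m m ℝ) (c cmax : ℝ) (p : ℝ[X]) (hc : 0 < c)
    (hAc : (A - c • (1 : Matrix m m ℝ)).PosSemidef)
    (hAcmax : (cmax • (1 : Matrix m m ℝ) - A).PosSemidef)
    (hp : ∀ x ∈ Set.Icc c cmax, 1 / x ≤ p.eval x) :
    (aeval A p - A⁻¹).PosSemidef := by
  have hA : IsSelfAdjoint A := isSelfAdjoint_of_isHermitian_sub_smul_one A c hAc.1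
  have hspec := spectrum_subset_Icc_of_posSemidef A c cmax hAc hAcmax
  have hne : ∀ x ∈ spectrum ℝ A, x ≠ 0 :=
    fun x hx => ne_of_gt (lt_of_lt_of_le hc (hspec x hx).1)
  have hcont : ContinuousOn (fun x : ℝ => x⁻¹) (spectrum ℝ A) :=
    continuousOn_inv₀.mono (fun x hx => hne x hx)
  rw [← Matrix.nonneg_iff_posSemidef, inv_eq_cfc_inv_of_spectrum_ne_zero A hA hne,
    ← cfc_polynomial p A, ← cfc_sub (fun x : ℝ => p.eval x) (fun x : ℝ => x⁻¹) A]
  apply cfc_nonneg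
  intro x hx
  have h := hp x (hspec x hx)
  rw [one_div] at h
  linarith

omit [DecidableEq m] in
/-- `yᵀ (Bᵀ X B) y = (B y)ᵀ X (B y)`. [folklore] -/
private theorem dotProduct_transpose_mul_mul_mulVec (B : Matrix m n ℝ) (X : Matrix m m ℝ) (y : n → ℝ) :
    y ⬝ᵥ ((Bᵀ * X * B) *ᵥ y) = (B *ᵥ y) ⬝ᵥ (X *ᵥ (B *ᵥ y)) := by
  rw [← mulVec_mulVec, ← mulVec_mulVec, dotProduct_mulVec, vecMul_transpose]

/-- **One-sided polynomial bound for the Schur complement.** Under the hypotheses of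
`aeval_sub_inv_posSemidef`, the explicit matrix `D − Bᵀ p(A) B` is below the Schur complement
`D − Bᵀ A⁻¹ B` in the Loewner order: `yᵀ(D − Bᵀ p(A) B)y ≤ yᵀ(D − Bᵀ A⁻¹ B)y` for every `y`
(`X ⪰ Y ⇒ S*XS ⪰ S*YS` applied to `p(A) ⪰ A⁻¹`). [cite: HornJohnson2013, Thm 7.7.2] -/
theorem schur_poly_dotProduct_le (A : Matrix m m ℝ) (B : Matrix m n ℝ) (D : Matrix n n ℝ)
    (c cmax : ℝ) (p : ℝ[X]) (hc : 0 < c)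
    (hAc : (A - c • (1 : Matrix m m ℝ)).PosSemidef)
    (hAcmax : (cmax • (1 : Matrix m m ℝ) - A).PosSemidef)
    (hp : ∀ x ∈ Set.Icc c cmax, 1 / x ≤ p.eval x) (y : n → ℝ) :
    y ⬝ᵥ ((D - Bᵀ * (aeval A p) * B) *ᵥ y) ≤ y ⬝ᵥ ((D - Bᵀ * A⁻¹ * B) *ᵥ y) := by
  have hM := aeval_sub_inv_posSemidef A c cmax p hc hAc hAcmax hp
  have h0 : 0 ≤ (B *ᵥ y) ⬝ᵥ ((aeval A p - A⁻¹) *ᵥ (B *ᵥ y)) := by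
    have := hM.dotProduct_mulVec_nonneg (B *ᵥ y)
    simpa only [star_trivial] using this
  rw [Matrix.sub_mulVec, Matrix.sub_mulVec, dotProduct_sub, dotProduct_sub,
    dotProduct_transpose_mul_mul_mulVec, dotProduct_transpose_mul_mul_mulVec]
  rw [Matrix.sub_mulVec, dotProduct_sub] at h0
  linarith

/-- **Polynomially filtered inertia certificate (counting form).** Let `[[A, B], [Bᵀ, D]]` be a real
symmetric block matrix with `c•1 ⪯ A ⪯ cmax•1`, `0 < c`, let `p` be a real polynomial with `1/x ≤ p(x)`
on `[c, cmax]`, and suppose the explicit matrix `D − Bᵀ p(A) B + Σ_j t_j q_j q_jᵀ` is positive semidefinite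
(in practice: one verified Cholesky factorisation; the `q_j` are arbitrary "deflation" vectors). Then the
block quadratic form is nonnegative on the subspace `{(x, y) : q_j ⬝ y = 0 for all j}`, of codimension
`≤ k`; by Courant–Fischer the block matrix has at most `k` negative eigenvalues. Composition of
`schur_poly_dotProduct_le` with Haynsworth's theorem in counting form
(`fromBlocks_dotProduct_nonneg_of_schur_posDef`; `H ⪰ 0 ⟺ A ≻ 0 ∧ H/A ⪰ 0`). [cite: Haynsworth1968, Thm 1]
[cite: HornJohnson2013, Thm 7.7.7] -/
theorem fromBlocks_dotProduct_nonneg_of_schur_poly_cert {k : ℕ} (A : Matrix m m ℝ) (B : Matrix m n ℝ)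
    (D : Matrix n n ℝ) (c cmax : ℝ) (p : ℝ[X]) (t : Fin k → ℝ) (q : Fin k → n → ℝ) (hc : 0 < c)
    (hAc : (A - c • (1 : Matrix m m ℝ)).PosSemidef)
    (hAcmax : (cmax • (1 : Matrix m m ℝ) - A).PosSemidef)
    (hp : ∀ x ∈ Set.Icc c cmax, 1 / x ≤ p.eval x)
    (hcert : (D - Bᵀ * (aeval A p) * B + ∑ j, t j • vecMulVec (q j) (q j)).PosSemidef)
    (x : m → ℝ) (y : n → ℝ) (hy : ∀ j, q j ⬝ᵥ y = 0) :
    0 ≤ (x ⊕ᵥ y) ⬝ᵥ (fromBlocks A B Bᵀ D *ᵥ (x ⊕ᵥ y)) := by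
  have hA : A.PosDef := posDef_of_posSemidef_sub_smul_one A c hc hAc
  have hBH : Bᴴ = Bᵀ := by
    ext i j
    simp [conjTranspose_apply]
  have hS : ∀ y : n → ℝ, (∀ j, q j ⬝ᵥ y = 0) → 0 ≤ y ⬝ᵥ ((D - Bᴴ * A⁻¹ * B) *ᵥ y) := by
    intro y hy
    have h1 : 0 ≤ y ⬝ᵥ ((D - Bᵀ * (aeval A p) * B) *ᵥ y) :=
      dotProduct_mulVec_nonneg_of_posSemidef_add (D - Bᵀ * (aeval A p) * B)
        (∑ j, t j • vecMulVec (q j) (q j)) q hcert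
        (fun y hy => dotProduct_sum_vecMulVec_mulVec_eq_zero t q y hy) y hy
    have h2 := schur_poly_dotProduct_le A B D c cmax p hc hAc hAcmax hp y
    rw [hBH]
    linarith
  have h := fromBlocks_dotProduct_nonneg_of_schur_posDef A B D hA
    (fun j => dotProductBilin ℝ ℝ (q j)) ?_ x y ?_
  · simpa [hBH] using h
  · intro y hy
    exact hS y (fun j => by simpa [dotProductBilin] using hy j)
  · intro j
    simpa [dotProductBilin] using hy j

end Literature.Analysis.OperatorTheory
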